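import Summits.BirchSwinnertonDyer.BirchSwinnertonDyer.Theorems.KolyvaginRankRigidityAtTwoSwapKummerEigenLinesAtTwo
import Summits.BirchSwinnertonDyer.BirchSwinnertonDyer.Theorems.KolyvaginRankRigidityAtTwoSwapPairingEvalOneSided
import Literature.NumberTheory.EllipticCurves.SelmerGaloisActionPlaces
import Literature.NumberTheory.GaloisRepresentations.LocalGlobalCohomologyFiniteProofs
import HarnessLib

/-!
# Crux V2♭θ `KolyvaginCorankLowerBoundAtTwoTheta` (stmt-BirchSwinnertonDyer-27220), line
# `kolyvagin_depth_split`, inside of S1, piece P7a — LOCAL FORM AT A KOLYVAGIN PRIME AT `2`: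
# the lower bound for an `s`-eigen functional on the local Kummer group, constant `2`
# (helper, PROVED; width seat `bsd-line-krr2-p2` g6)

Assembly of the seat's pieces: `kummer_eigen_at_two` (count `≤ 2^{k+1}` and an eigen-class of order
`2^k` in `Kum_v ∩ ker(σ_* − s)`), `SwapPairing.exists_eq_zsmul_add_of_card_le_of_mem` (hence that
eigen-part is `ℤ g + 2`-torsion) and `SwapPairing.pow_smul_eval_ne_zero_of_eigen` (the one-sided
eigen-line estimate).  Result (`kummer_eval_pow_smul_ne_zero_at_two`): for `K` imaginary quadratic,
`τ` its non-trivial automorphism, `ℓ` a Zhang–Kolyvagin prime at `2` with `1 ≤ k ≤ M(ℓ)` and Gross's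
condition `FrobEqFrobInfty W K (2^{M'}) ℓ` (`k ≤ M'`), `v ∋ ℓ`, `s = ±1`, and ANY additive functional
`φ` on `H¹(K_v, E[2^k])` into a `2^k`-torsion group with `φ(σ_* a) = s φ(a)` on `Kum_v` (e.g.
`φ = ⟨·, y⟩_v` for a dual class `y` with `σ_* y = s y`, by the `τ`-invariance of the local Tate pairing):
an `s`-eigen-class `x ∈ Kum_v` with `2^i x ≠ 0`, some `a ∈ Kum_v` with `2^j φ(a) ≠ 0`, and
`k + 2 ≤ i + j + 1` give `2^{i+j+1-k-2} φ(x) ≠ 0`.  The remaining hypothesis `hexp` (`2^k` kills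
`Kum_v`) is the exponent of `H¹(K_v, E[2^k])`.  What is left for the lead's P7a in global currency is
bookkeeping: `loc ∘ conjAct = conjActPlace ∘ loc`, `conjActPlaceDual (loc (w_* C)) = s • loc (w_* C)`
(`map_weilDual_conjAct`, `conjActPlaceDual_localization`), `localTatePairingZMod_conjActPlace`, and
`2^b loc C ∉ Kum_v ⇒ ∃ a ∈ Kum_v, 2^b ⟨a, w_* loc C⟩ ≠ 0` (`dualTransported_kummerSelmerStructure_inr`).
HONEST FRAMING: helper (`--supports` 27220); S1 / V2♭θ are NOT proved; BSD is not proved.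

References: [Kolyvagin1991MathAnn] §2; [Jetchev2008] §3.2, Prop. 4.2; [GrossLMS1991] §3–§4.
-/

set_option autoImplicit false
-- the Theorems namespace of this sub repeats the summit name by design (D-0017 nested layout)
set_option linter.dupNamespace false

noncomputable section

open scoped Classical Pointwise NumberField
open WeierstrassCurve Field Function NumberField IsDedekindDomain
open Literature.NumberTheory.EllipticCurves Literature.NumberTheory.GaloisRepresentations
open Literature.NumberTheory.GaloisCohomology Literature.NumberTheory.Automorphic

namespace Summit.BirchSwinnertonDyer.BirchSwinnertonDyer.Theorems.KolyvaginLowerBoundAtTwo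

variable (W : WeierstrassCurve ℚ) (K : Type) [Field K] [NumberField K] [W.IsElliptic] [W.IsGloballyMinimal]

/-- **Local P7a at a Kolyvagin prime at `2` (constant `2`).** `K` imaginary quadratic with
non-trivial automorphism `τ` (`τ² = 1`), `ℓ` a Zhang–Kolyvagin prime at `2` with `1 ≤ k ≤ M(ℓ)` and
`FrobEqFrobInfty W K (2^{M'}) ℓ` (`k ≤ M'`), `v ∋ ℓ`, `τ • v = v`, `s = ±1`; `φ` an additive map on
`H¹(K_v, E[2^k])` into a group killed by `2^k` with `φ (σ_* a) = s • φ a` for `a ∈ Kum_v`; `2^k`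
kills `Kum_v`. Then for an `s`-eigen-class `x ∈ Kum_v` of `σ_* = conjActPlace W τ (2^k) hfix`:
`2^i • x ≠ 0 → (∃ a ∈ Kum_v, 2^j • φ a ≠ 0) → k + 2 ≤ i + j + 1 → 2^{i+j+1-k-2} • φ x ≠ 0`.
[cite: Kolyvagin1991MathAnn, §2 (proof of Thm. 2.2)] [cite: Jetchev2008, §3.2 (2)–(3), Prop. 4.2] -/
theorem kummer_eval_pow_smul_ne_zero_at_two (hK : IsImaginaryQuadratic K) {k ℓ M' : ℕ} (hk1 : 1 ≤ k)
    (hℓ : Zhang2014.IsKolyvaginPrime (W.conductorNorm ℤ) W K 2 ℓ)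
    (hk : k ≤ Zhang2014.kolyvaginIndex W 2 ℓ) (hF : FrobEqFrobInfty W K (2 ^ M') ℓ) (hkM' : k ≤ M')
    (v : HeightOneSpectrum (𝓞 K)) (hv : (ℓ : 𝓞 K) ∈ v.asIdeal)
    {τ : K ≃ₐ[ℚ] K} (hτ1 : τ ≠ 1) (hττ : τ * τ = 1) (hfix : τ • v = v) {s : ℤ} (hs : s = 1 ∨ s = -1)
    (hexp : ∀ c ∈ (W.baseChange K).kummerSelmerStructure ((2 ^ k : ℕ) : ℤ) (Sum.inr v : Place K),
      (2 : ℤ) ^ k • c = 0)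
    {C : Type*} [AddCommGroup C] (hC : ∀ c : C, (2 : ℤ) ^ k • c = 0)
    (Φ : galoisCohomology
        (((W.baseChange K).torsionGaloisModule ((2 ^ k : ℕ) : ℤ)).toLocal (Sum.inr v : Place K)) 1 →+ C)
    (hΦ : ∀ a ∈ (W.baseChange K).kummerSelmerStructure ((2 ^ k : ℕ) : ℤ) (Sum.inr v : Place K),
      Φ (conjActPlace W τ ((2 ^ k : ℕ) : ℤ) hfix a) = s • Φ a)
    {x : galoisCohomology
        (((W.baseChange K).torsionGaloisModule ((2 ^ k : ℕ) : ℤ)).toLocal (Sum.inr v : Place K)) 1}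
    (hxK : x ∈ (W.baseChange K).kummerSelmerStructure ((2 ^ k : ℕ) : ℤ) (Sum.inr v : Place K))
    (hx : conjActPlace W τ ((2 ^ k : ℕ) : ℤ) hfix x = s • x) {i j : ℕ} (hi : (2 : ℤ) ^ i • x ≠ 0)
    (hj : ∃ a ∈ (W.baseChange K).kummerSelmerStructure ((2 ^ k : ℕ) : ℤ) (Sum.inr v : Place K),
      (2 : ℤ) ^ j • Φ a ≠ 0)
    (hM : k + 2 ≤ i + j + 1) :
    (2 : ℤ) ^ (i + j + 1 - k - 2) • Φ x ≠ 0 := by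
  -- finiteness of the local `H¹`
  haveI : Finite (geomTorsion (W.baseChange K) ((2 ^ k : ℕ) : ℤ)) :=
    finite_torsionPoints_holds (W.baseChange K) (AlgebraicClosure K) (by positivity)
  haveI : Finite (galoisCohomology
      (((W.baseChange K).torsionGaloisModule ((2 ^ k : ℕ) : ℤ)).toLocal (Sum.inr v : Place K)) 1) :=
    finite_galoisCohomology_one_toLocal ((W.baseChange K).torsionGaloisModule ((2 ^ k : ℕ) : ℤ)) v
  -- the eigen-part of `Kum_v`: count and an element of order `2^k`
  obtain ⟨hcount, g, hgmem, hgne⟩ := kummer_eigen_at_two W K hK hk1 hℓ hk hF hkM' v hv hτ1 hfix hs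
  have hmemS : ∀ {y}, y ∈ (W.baseChange K).kummerSelmerStructure ((2 ^ k : ℕ) : ℤ) (Sum.inr v : Place K) ⊓
      (conjActPlace W τ ((2 ^ k : ℕ) : ℤ) hfix - s • AddMonoidHom.id _).ker ↔
      y ∈ (W.baseChange K).kummerSelmerStructure ((2 ^ k : ℕ) : ℤ) (Sum.inr v : Place K) ∧
        conjActPlace W τ ((2 ^ k : ℕ) : ℤ) hfix y = s • y := fun {y} => by
    rw [AddSubgroup.mem_inf, AddMonoidHom.mem_ker, AddMonoidHom.sub_apply, AddMonoidHom.smul_apply,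
      AddMonoidHom.id_apply, sub_eq_zero]
  have hgK := (hmemS.mp hgmem).1
  have hgz : (2 : ℤ) ^ (k - 1) • g ≠ 0 := by
    rw [← natCast_zsmul] at hgne
    exact_mod_cast hgne
  have hSfin : (((W.baseChange K).kummerSelmerStructure ((2 ^ k : ℕ) : ℤ) (Sum.inr v : Place K) ⊓
      (conjActPlace W τ ((2 ^ k : ℕ) : ℤ) hfix - s • AddMonoidHom.id _).ker : AddSubgroup _) :
      Set (galoisCohomology
        (((W.baseChange K).torsionGaloisModule ((2 ^ k : ℕ) : ℤ)).toLocal (Sum.inr v : Place K)) 1)).Finite :=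
    Set.toFinite _
  have hexpS : ∀ y ∈ (W.baseChange K).kummerSelmerStructure ((2 ^ k : ℕ) : ℤ) (Sum.inr v : Place K) ⊓
      (conjActPlace W τ ((2 ^ k : ℕ) : ℤ) hfix - s • AddMonoidHom.id _).ker, (2 : ℤ) ^ k • y = 0 :=
    fun y hy => hexp y (hmemS.mp hy).1
  -- the eigen-part is `ℤ g + 2`-torsion
  have hline : ∀ y ∈ (W.baseChange K).kummerSelmerStructure ((2 ^ k : ℕ) : ℤ) (Sum.inr v : Place K),
      conjActPlace W τ ((2 ^ k : ℕ) : ℤ) hfix y = s • y →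
        ∃ (c : ℤ) (t : galoisCohomology
          (((W.baseChange K).torsionGaloisModule ((2 ^ k : ℕ) : ℤ)).toLocal (Sum.inr v : Place K)) 1),
          t ∈ (W.baseChange K).kummerSelmerStructure ((2 ^ k : ℕ) : ℤ) (Sum.inr v : Place K) ∧
            (2 : ℤ) • t = 0 ∧ y = c • g + t := by
    intro y hyK hy
    obtain ⟨c, t, htS, ht2, hye⟩ := SwapPairing.exists_eq_zsmul_add_of_card_le_of_mem hk1 _ hSfin
      hcount hexpS hgmem hgz (hmemS.mpr ⟨hyK, hy⟩)
    exact ⟨c, t, (hmemS.mp htS).1, ht2, hye⟩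
  -- `σ_*` preserves `Kum_v` and is an involution
  have hιK : ∀ a ∈ (W.baseChange K).kummerSelmerStructure ((2 ^ k : ℕ) : ℤ) (Sum.inr v : Place K),
      conjActPlace W τ ((2 ^ k : ℕ) : ℤ) hfix a ∈
        (W.baseChange K).kummerSelmerStructure ((2 ^ k : ℕ) : ℤ) (Sum.inr v : Place K) := fun a ha =>
    conjActPlace_mem_kummerSelmerStructure W τ ((2 ^ k : ℕ) : ℤ) hfix ha
  have hιι : ∀ a ∈ (W.baseChange K).kummerSelmerStructure ((2 ^ k : ℕ) : ℤ) (Sum.inr v : Place K),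
      conjActPlace W τ ((2 ^ k : ℕ) : ℤ) hfix (conjActPlace W τ ((2 ^ k : ℕ) : ℤ) hfix a) = a :=
    fun a _ => conjActPlace_conjActPlace W τ ((2 ^ k : ℕ) : ℤ) hττ hfix hfix a
  exact SwapPairing.pow_smul_eval_ne_zero_of_eigen (conjActPlace W τ ((2 ^ k : ℕ) : ℤ) hfix) hs
    ((W.baseChange K).kummerSelmerStructure ((2 ^ k : ℕ) : ℤ) (Sum.inr v : Place K)) hιK hιι hexp hgK
    hline Φ hΦ hC hxK hx hi hj hM

end Summit.BirchSwinnertonDyer.BirchSwinnertonDyer.Theorems.KolyvaginLowerBoundAtTwo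

end
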